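import Summits.BirchSwinnertonDyer.BirchSwinnertonDyer.Theorems.Rank1ResidualX9Defs
import Literature.NumberTheory.EllipticCurves.Rank1Residual.MuLambdaCarriers
import Literature.NumberTheory.IwasawaTheory.ClassicalMuInvariant
import Literature.NumberTheory.EllipticCurves.DivisionField
import Literature.NumberTheory.EllipticCurves.GaloisAction
import HarnessLib
import HarnessLib.Audit

/-!
# The CONJ-A ROAD to the node `KatoDivisibilityOnClassX9`: Coates–Sujatha's Conjecture A on class X9
# and its two class-group sources (classical Iwasawa `μ = 0` of `ℚ(E[p])`, resp. of ONE torsion-point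
# field `ℚ(P)`) — the cell's descent-lens gen-1 nodes, filed as OPEN obligation nodes (`@[conjecture] def`)

HONEST FRAMING (cell `bsd-f3-mu`, D-0131 (3) FRONTIER TIER, HOME `run/shared/lean/pub/bsd-f3-mu/`).
TYPER's filing of the `-desc` lens's generation-1 statements (MEMO-desc §9 «THE CONJ-A ROAD»,
`HOME/desc/Sketch2.lean` sha16 b490b220666e0690, rc 0; local BC7 5/5 CLEAN, `HOME/desc/Probe2.verdicts.txt`):
a pure CONJECTURE LEAF — only `@[conjecture] def`s, no theorem, nothing asserted, typed ≠ proved ≠ endorsed.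
THESIS of the road (desc g1): for `BSD_p` on X9 one needs only the `μ`-defect `k = μ(X) − μ(L_p) ≤ 0`
(the cell node; the landed squeeze `bsdpOnClassX9_of_katoDivisibility_squeeze` does the rest); Kato
§17.13 at the height-one prime `(p)` gives `k ≤ μ(X₀)` with `X₀` the dual FINE Selmer module (Literature
carrier `Rank1Residual.MuDefectLeFineMuAt`, S-W⁺, a prover's item from F1; Wuthrich 2006 Thm 2 / Lemma 3
mechanism, image-free beyond `Irr`), so Conjecture A at the pair (`μ(X₀) = 0`) ALONE forces the node at
the pair — and for the fine Selmer group the tame-image dictionary is unit-free: (A) at `(E, p)` follows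
from the classical `μ_p(ℚ(E[p])^{cyc}) = 0` (Coates–Sujatha 2005 Thm 3.4 = tree fact
`CoatesSujatha2005.thm34_…`) and, by the desc lens's paper lemma T2 (tame isotypic restriction to
`Stab(P)`, `p ∤ #G`), already from `μ_p(ℚ(P)^{cyc}) = 0` for ONE nonzero `P ∈ E[p]` (degree 8 / 12 / 24
on X9).  NO `μ(X) = 0`, NO `μ(L_p) = 0`, NO unit/Coleman (Ray Conj 5.3) condition on this road.
Per-pair predicates (`ConjAAt`, `FineMuZeroAt`, `MuDefectLeFineMuAt`) live in the Literature carrier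
module `Rank1Residual/MuLambdaCarriers.lean` §5; the kernel glue (general Conj A node ⟹ DESC-A; K1 ⟹
DESC-A by CS05 Thm 3.4; K1′ ⟹ DESC-A given T2; DESC-A + T0 + S-W⁺ + F1 + BCS (a) ⟹ the node; the road to
`BSDpOnClassX9`) lives in the sibling `ConjARoadEdges.lean`, with the provable support items T0
(`ConjAAt → FineMuZeroAt`), T2 and S-W⁺ as explicit HYPOTHESES (prover items, never asserted).

## Provenance (cell record)

* MEMO-desc.md §9 + STATUS 15:10:40Z (planner `-desc` g1): nodes **DESC-A `ConjAOnClassX9`**, **K1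
  `DivisionFieldClassicalMuZeroOnClassX9`**, **K1′ `TorsionPointFieldClassicalMuZeroOnClassX9`**; support
  items T0 (S), T2 (M, needs definition D4 = `Sel₀(E[p]/ℚ_∞) ≃ Hom_G(X'(ℚ(E[p])_∞)/p, E[p])` for
  `p ∤ #G`, or a paper-node), S-W⁺ (M, mod `Kato2004.exists_divisibilityInputs_fineQuotient`); per-pair
  certificate road = Deo–Ray–Sujatha 2023 Thm 3.9 (tree fact `DeoRaySujatha2023.thm39_…`, class-number /
  `Hom_G` forms) — the BC5 / census shape (column requests (d3)/(d6) to `-data`).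
* Relation to the landed desc nodes (p538255): `TorsionPointFieldMuSufficesOnClassX9` (DESC-C1′,
  conclusion `μ(X) = 0`) is NOT on this road — its conclusion is stronger than the node needs and costs
  Ray's Conj 5.3; the road uses only its HYPOTHESIS, which is exactly K1′ below.
* Refuter verdicts: REF1-AUDIT.md §3.2 / REF2-LITMAP.md §3 gen-2 rows (CANDIDATES.md §1 rows 7–9 carry the
  codes of record; ref2 13:54Z already placed the dictionary: «desc-T-D PROVABLE, not verbatim in print;
  pieces in print: GV00 2.8/EPW §4 pattern, GV-Artin I §3–4, Ray 2023 §5»).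
* BC5 witness: on the 789–790/790 certified census pairs (`μ_an = 0`) the node holds (19629 mod F1 +
  BCS (a)), hence nothing on the `μ`-table can refute DESC-A's CONSEQUENCES; DESC-A / K1′ themselves are
  decided per pair by class groups: Fukuda (`IwasawaTheory.classicalMuVanishes_of_classGroupPRank_succ_eq`)
  for K1′, DRS Thm 3.9 for (A) — columns (d3)/(d6) requested; DRS23 p. 10 L54: no such example in print.
* Why (planner): the road DECIDES the node pair-by-pair from class groups of degree-8/12/24 fields with
  no `L`-function and no Euler-system input, and isolates the one open class-wide statement as instances
  of Iwasawa's classical `μ`-conjecture for those fields.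

References: [CoatesSujatha2005] Conj. A, Thm. 3.4; [DeoRaySujatha2023] Thm. 3.9; [Kato2004Asterisque]
§17.13; [Wuthrich2006] Thm. 2, Lemma 3; [Ray2023] Conj. 5.3 (what is NOT needed); [GreenbergLNM1716]
Conj. 1.11; HOME MEMO-desc.md §9, desc/Sketch2.lean, CANDIDATES.md §1.
-/

-- the summit and its single problem are both named `BirchSwinnertonDyer` (registry layout D-0017)
set_option linter.dupNamespace false

noncomputable section

open scoped Classical

open WeierstrassCurve Literature.NumberTheory.EllipticCurves Literature.NumberTheory.IwasawaTheory
  Summit.BirchSwinnertonDyer.BirchSwinnertonDyer.Rank1Residual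
open Literature.NumberTheory.EllipticCurves.Rank1Residual (ConjAAt)

namespace Summit.BirchSwinnertonDyer.Rank1Residual.SmallImageMu

/-- **DESC-A — Coates–Sujatha's Conjecture A on class X9 (OPEN class-wide; certified per pair by class
groups; nothing asserted).**  At every X9 pair `(E, p)` (non-CM, `p ≥ 5` good ordinary, `E[p]` irreducible
and NOT surjective): statement (A) at the pair over `ℚ^{cyc}` (`Rank1Residual.ConjAAt W p`: for every
cyclotomic `κ` some dual datum of `Sel₀(ℚ_∞, E[p^∞])` is finitely generated over `ℤ_p`).  The
instantiation on X9 of the general node `FineSelmer.CoatesSujathaConjectureA` (edges file); with T0 +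
S-W⁺ + F1 + BCS (a) it forces the cell node `KatoDivisibilityOnClassX9` (edges file).  Verbatim
`HOME/desc/Sketch2.lean`.
[cite: CoatesSujatha2005, Conjecture A (§3) — OPEN; here restricted to class X9] -/
@[conjecture] def ConjAOnClassX9 : Prop :=
  ∀ (W : WeierstrassCurve ℚ) [W.IsElliptic] [W.IsGloballyMinimal] (p : ℕ) [Fact p.Prime],
    ClassX9 W p → ConjAAt W p

/-- **K1 — classical Iwasawa `μ = 0` for the division fields on class X9 (OPEN: instances of Iwasawa's
`μ`-conjecture for the non-abelian fields `ℚ(E[p])`, degree 32 / 72 / 96; nothing asserted).**  Spelled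
EXACTLY as the hypothesis of the tree fact `CoatesSujatha2005.thm34_fineSelmerDual_moduleFinite_of_classicalMuVanishes_divisionField`,
so that K1 ⟹ DESC-A is an application (edges file).  Verbatim `HOME/desc/Sketch2.lean`.
[cite: CoatesSujatha2005, Thm. 3.4 (§3) — the implication it feeds; the hypothesis itself is Iwasawa's μ-conjecture, OPEN for these fields]
[cite: Washington1997, §7.5 and §13.3 — Iwasawa's μ = 0 conjecture; Ferrero–Washington for abelian fields only] -/
@[conjecture] def DivisionFieldClassicalMuZeroOnClassX9 : Prop :=
  ∀ (W : WeierstrassCurve ℚ) [W.IsElliptic] [W.IsGloballyMinimal] (p : ℕ) [Fact p.Prime],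
    ClassX9 W p →
    (haveI : NeZero p := ⟨(Fact.out : p.Prime).ne_zero⟩
     ∀ κL : ZpExtension (W.divisionField p) p, κL.IsCyclotomic → ClassicalMuVanishes κL)

/-- **K1′ — classical Iwasawa `μ = 0` for ONE torsion-point field on class X9 (OPEN class-wide; finitely
certifiable per pair by Fukuda's criterion; nothing asserted).**  At every X9 pair there is a nonzero
`P ∈ E[p](ℚ̄)` whose field `ℚ(P)` (the fixed field of `Stab_{Γ_ℚ}(P)`; degree 8 = 5Ns-axis / 12 = 7Ns-axis
/ 24 = 5S4 for an eigenline point) has `ClassicalMuVanishes κ` for every cyclotomic `κ`.  Exactly the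
HYPOTHESIS part of the landed `TorsionPointFieldMuSufficesOnClassX9` (DESC-C1′); with the paper lemma T2
(tame isotypic restriction) it gives DESC-A (edges file).  Verbatim `HOME/desc/Sketch2.lean`.
[cite: CoatesSujatha2005, Thm. 3.4 (§3) — the division-field form it sharpens; OPEN]
[cite: Washington1997, §7.5 and §13.3 — Iwasawa's μ = 0 conjecture] -/
@[conjecture] def TorsionPointFieldClassicalMuZeroOnClassX9 : Prop :=
  ∀ (W : WeierstrassCurve ℚ) [W.IsElliptic] [W.IsGloballyMinimal] (p : ℕ) [Fact p.Prime],
    ClassX9 W p →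
    ∃ P : geomTorsion W (p : ℤ), P ≠ 0 ∧
      ∀ κ : ZpExtension
          (IntermediateField.fixedField (MulAction.stabilizer (Field.absoluteGaloisGroup ℚ) P)) p,
        κ.IsCyclotomic → ClassicalMuVanishes κ

end Summit.BirchSwinnertonDyer.Rank1Residual.SmallImageMu

end
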